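import Mathlib
import Summits.NavierStokesRegularity.NavierStokesRegularity.Theses.LevelSetModeration
import Summits.NavierStokesRegularity.NavierStokesRegularity.Theorems.LevelSetModerationLevelSetClosureTruncation
import Summits.NavierStokesRegularity.NavierStokesRegularity.Theorems.LevelSetModerationLevelSetClosureTools
import Summits.NavierStokesRegularity.NavierStokesRegularity.Theorems.LevelSetModerationLevelSetClosureStampacchia

/-!
# Route LevelSetModeration — crux `LevelSetClosure` (stmt-NavierStokesRegularity-18150): line skeleton

Line `Sketch-ideator2` / idea `volume-recursion` (lead prover, v1: stubs truncation/levelSetTools/stampacchia LANDED and imported; sliceGain needs `0 ≤ k`, timeStep drops the idle `0 ≤ S`).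

Composition: `LevelSetEnergyInequality` (route item 18151, taken BY NAME as a hypothesis) chained
with the crux hypothesis gives the pressure-free combined level-set inequality (CLI); the PDE-free
extinction theorem `stub_extinction` (C⁺: a continuous field with `C¹ ∩ L²` slices obeying CLI is
bounded) then gives the crux by name (`levelSetClosure_of`). The leaves of `stub_extinction`
(proved separately and `--supports`-landed): `stub_truncation` (a `C¹` two-level truncation of the
speed), `stub_sliceGain` (Chebyshev + `L²–L⁶` interpolation + whole-space GNS for one slice),
`stub_timeStep` (time integration of the slice gain), `stub_levelSetTools` (monotone limit of the
dissipation in `t`, open-null-empty endgame, zero-excess endgame), `stub_stampacchia`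
(Stampacchia's lemma from the landed `IterationLemma`).
-/

noncomputable section

-- single-conjunct summit: `Summit.<Summit>.<Problem>` repeats the name by the D-0017 layout
set_option linter.dupNamespace false

open MeasureTheory Set Filter Topology Function
open scoped ENNReal NNReal

namespace Summit.NavierStokesRegularity.NavierStokesRegularity.Theorems.LevelSetClosure

open Summit.NavierStokesRegularity.NavierStokesRegularity.Theses.LevelSetModeration
open Literature.Analysis.FluidPDE

/-! ### Registered stubs -/

/-- **Stub S2 (slice volume gain).** Chebyshev on `L^{10/3}` for the truncation `w`, the
interpolation `∫|w|^{10/3} ≤ (∫|w|²)^{2/3} (∫|w|⁶)^{1/3}` and the whole-space GNS inequality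
`‖w‖₆ ≤ K ‖∇w‖₂` (`K = SNormLESNormFDerivOfEqConst ℝ volume 2`) bound the volume of `{|v| > h}` by
`(4/(h-k))^{10/3} K² (∫(|v|-k)₊²)^{2/3} ∫ 1_{|v|>k}|∇|v||²`. -/
theorem stub_sliceGain :
    ∀ (v : EuclideanSpace ℝ (Fin 3) → EuclideanSpace ℝ (Fin 3)) (w : EuclideanSpace ℝ (Fin 3) → ℝ)
      (k h : ℝ), MeasureTheory.MemLp v 2 volume → 0 ≤ k → k < h → ContDiff ℝ 1 w → (∀ x, 0 ≤ w x) →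
      (∀ x, w x ^ 2 ≤ (max (‖v x‖ - k) 0) ^ 2) → (∀ x, h < ‖v x‖ → (h - k) / 4 ≤ w x) →
      (∀ x, ‖fderiv ℝ w x‖ ≤
        Set.indicator {x | k < ‖v x‖} (fun x => ‖fderiv ℝ (fun y => ‖v y‖) x‖) x) →
      volume {x | h < ‖v x‖} ≤
        ENNReal.ofReal ((4 / (h - k)) ^ (10 / 3 : ℝ)) *
          (MeasureTheory.SNormLESNormFDerivOfEqConst ℝ
              (volume : Measure (EuclideanSpace ℝ (Fin 3))) 2 : ℝ≥0∞) ^ 2 *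
          (∫⁻ x, ENNReal.ofReal ((max (‖v x‖ - k) 0) ^ 2)) ^ (2 / 3 : ℝ) *
          ∫⁻ x, Set.indicator {x | k < ‖v x‖}
            (fun x => ENNReal.ofReal (‖fderiv ℝ (fun y => ‖v y‖) x‖ ^ 2)) x := by
  sorry

/-- **Stub S3 (time integration of the slice gain).** If every slice `τ ∈ (0,T)` obeys a volume
gain with constant `C` and its truncated energy at level `k` is at most `S`, then the space–time
volume of `{|u| > h}` is at most `C S^{2/3}` times the level-set dissipation at level `k`. -/
theorem stub_timeStep :
    ∀ (u : ℝ → EuclideanSpace ℝ (Fin 3) → EuclideanSpace ℝ (Fin 3)) (T k h S : ℝ) (C : ℝ≥0∞),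
      C ≠ ⊤ →
      (∀ τ ∈ Set.Ioo 0 T, MeasureTheory.Integrable (fun x => (max (‖u τ x‖ - k) 0) ^ 2) volume) →
      (∀ τ ∈ Set.Ioo 0 T, ∫ x, (max (‖u τ x‖ - k) 0) ^ 2 ≤ S) →
      (∀ τ ∈ Set.Ioo 0 T, volume {x | h < ‖u τ x‖} ≤
        C * (∫⁻ x, ENNReal.ofReal ((max (‖u τ x‖ - k) 0) ^ 2)) ^ (2 / 3 : ℝ) *
          ∫⁻ x, Set.indicator {x | k < ‖u τ x‖}
            (fun x => ENNReal.ofReal (‖fderiv ℝ (fun y => ‖u τ y‖) x‖ ^ 2)) x) →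
      (∫⁻ τ in Set.Ioo 0 T, volume {x | h < ‖u τ x‖}) ≤
        C * ENNReal.ofReal S ^ (2 / 3 : ℝ) *
          ∫⁻ τ in Set.Ioo 0 T, ∫⁻ x, Set.indicator {x | k < ‖u τ x‖}
            (fun x => ENNReal.ofReal (‖fderiv ℝ (fun y => ‖u τ y‖) x‖ ^ 2)) x := by
  sorry

/-- **Registered tools stub `stub_extinctionAlgebra`**: the conjunction of the five real-variable
lemmas of this file (absorption, threshold, recursion/base/threshold algebra). -/
theorem stub_extinctionAlgebra :
    (∀ (ν A dT T : ℝ) (e d : ℝ → ℝ), 0 < ν → 0 ≤ A → 0 ≤ dT →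
      (∀ t ∈ Set.Ico 0 T, 0 ≤ e t) → (∀ t ∈ Set.Ico 0 T, 0 ≤ d t) →
      (∀ t ∈ Set.Ico 0 T, e t + 2 * ν * d t ≤ 2 * (Real.sqrt A * Real.sqrt dT)) →
      (∀ r, 0 ≤ r → (∀ t ∈ Set.Ico 0 T, d t ≤ r) → dT ≤ r) →
      dT ≤ A / ν ^ 2 ∧ ∀ t ∈ Set.Ico 0 T, e t ≤ 2 * A / ν) ∧
    (∀ (Θ m M₁ : ℝ), m < 10 / 3 →
      ∃ M : ℝ, M₁ ≤ M ∧ 1 ≤ M ∧ Θ * M ^ (5 * m / 3 - 50 / 9) ≤ 1) ∧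
    (∀ (Λ ν M m k h Kr Vh Vk Dk : ℝ), 0 < Λ → 0 < ν → 0 < M → k < h → 0 ≤ Vk →
      Vh ≤ (4 / (h - k)) ^ (10 / 3 : ℝ) * Kr ^ 2 * (2 * Λ * M ^ m * Vk / ν) ^ (2 / 3 : ℝ) * Dk →
      Dk ≤ Λ * M ^ m * Vk / ν ^ 2 →
      Vh ≤ (4 : ℝ) ^ (10 / 3 : ℝ) * Kr ^ 2 * (2 * Λ / ν) ^ (2 / 3 : ℝ) * (Λ / ν ^ 2) *
        (M ^ m) ^ (5 / 3 : ℝ) / (h - k) ^ (10 / 3 : ℝ) * Vk ^ (5 / 3 : ℝ)) ∧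
    (∀ (M M₀ Kr E₀ D₀ Vhalf : ℝ), 0 < M₀ → 2 * M₀ ≤ M → 0 ≤ E₀ → 0 ≤ D₀ →
      Vhalf ≤ (4 / (M / 2 - M₀ / 2)) ^ (10 / 3 : ℝ) * Kr ^ 2 * E₀ ^ (2 / 3 : ℝ) * D₀ →
      Vhalf ≤ (16 : ℝ) ^ (10 / 3 : ℝ) * Kr ^ 2 * E₀ ^ (2 / 3 : ℝ) * D₀ * M ^ (-(10 / 3 : ℝ))) ∧
    (∀ (Γ Cb Vhalf M m : ℝ), 0 ≤ Γ → 0 ≤ Cb → 0 ≤ Vhalf → 1 ≤ M →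
      Vhalf ≤ Cb * M ^ (-(10 / 3 : ℝ)) →
      Γ * Cb ^ (2 / 3 : ℝ) * (2 : ℝ) ^ (35 / 3 : ℝ) * M ^ (5 * m / 3 - 50 / 9) ≤ 1 →
      Γ * (M ^ m) ^ (5 / 3 : ℝ) * Vhalf ^ ((5 / 3 : ℝ) - 1) *
          (2 : ℝ) ^ ((10 / 3 : ℝ) * (5 / 3) / ((5 / 3 : ℝ) - 1)) ≤ (M / 2) ^ (10 / 3 : ℝ)) :=
  sorry

/-- **Stub S6 (PDE-free extinction, C⁺ — the lead's own stub; composed from S1–S5).** A jointly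
continuous field on `[0,T) × ℝ³` with `C¹`, square-integrable slices of energy `≤ E₀`, initially
below `M₀/2`, obeying the combined level-set inequality CLI for every window `[M/2, M]`, `M ≥ M₀`,
with `m < 10/3`, is bounded on `[0,T)`. -/
theorem stub_extinction :
    ∀ (ν T Λ m M₀ E₀ : ℝ), 0 < ν → 0 < T → m < 10 / 3 → 0 < M₀ →
    ∀ (u : ℝ → EuclideanSpace ℝ (Fin 3) → EuclideanSpace ℝ (Fin 3)),
      ContinuousOn (Function.uncurry u) (Set.Ico 0 T ×ˢ Set.univ) →
      (∀ t ∈ Set.Ico 0 T, ContDiff ℝ 1 (u t)) →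
      (∀ t ∈ Set.Ico 0 T, MeasureTheory.MemLp (u t) 2 volume) →
      (∀ t ∈ Set.Ico 0 T, ∫ x, ‖u t x‖ ^ 2 ≤ E₀) →
      (∀ x, ‖u 0 x‖ ≤ M₀ / 2) →
      (∀ (M c t : ℝ), M₀ ≤ M → M / 2 ≤ c → c ≤ M → t ∈ Set.Ico 0 T →
        (∫ x, (max (‖u t x‖ - c) 0) ^ 2) +
            2 * ν * (∫⁻ τ in Set.Ioo 0 t, ∫⁻ x, Set.indicator {x | c < ‖u τ x‖}
              (fun x => ENNReal.ofReal (‖fderiv ℝ (fun y => ‖u τ y‖) x‖ ^ 2)) x).toReal ≤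
          2 * (Real.sqrt (Λ * M ^ m * (∫⁻ τ in Set.Ioo 0 T, volume {x | c < ‖u τ x‖}).toReal) *
            Real.sqrt ((∫⁻ τ in Set.Ioo 0 T, ∫⁻ x, Set.indicator {x | c < ‖u τ x‖}
              (fun x => ENNReal.ofReal (‖fderiv ℝ (fun y => ‖u τ y‖) x‖ ^ 2)) x).toReal))) →
      ∃ B : ℝ, ∀ t ∈ Set.Ico 0 T, ∀ x, ‖u t x‖ ≤ B := by
  sorry

/-! ### The transfer: C⁺ and item 18151 give the crux by name -/

/-- **Skeleton theorem.** `LevelSetEnergyInequality` (route item stmt-18151) and the PDE-free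
extinction `stub_extinction` give `LevelSetClosure` BY NAME: the level-set energy inequality and the
crux hypothesis combine (`linarith`, the two pressure pairings are syntactically identical) into
CLI; the Leray–Hopf structure supplies `L²` slices and the energy bound `E₀ = 2 E(u₀)`, the classical
structure supplies joint continuity and `C¹` slices. -/
theorem levelSetClosure_of (hE : LevelSetEnergyInequality) : LevelSetClosure := by
  intro ν T hν hT u p hcl hLH hdec m Λ M₀ hm hM₀ hu0 hPW
  refine stub_extinction ν T Λ m M₀ (2 * VectorCalculus.kineticEnergy (u 0)) hν hT hm hM₀ u
    ?_ ?_ ?_ ?_ hu0 ?_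
  · exact hcl.smooth_velocity.continuousOn
  · intro t ht
    exact (hcl.contDiff_velocity ht).of_le (by exact_mod_cast le_top)
  · intro t ht
    exact hLH.memLp t (Ico_subset_Icc_self ht)
  · intro t ht
    obtain ⟨G, -, hineq⟩ := hLH.energy_ineq_zero
    have h := hineq t (Ico_subset_Icc_self ht)
    simp only [Pi.zero_apply, inner_zero_left, integral_zero, intervalIntegral.integral_zero,
      add_zero] at h
    have hK : VectorCalculus.kineticEnergy (u t) ≤ VectorCalculus.kineticEnergy (u 0) :=
      le_trans (le_add_of_nonneg_right (mul_nonneg hν.le ENNReal.toReal_nonneg)) h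
    have h2 : ∫ x, ‖u t x‖ ^ 2 = 2 * VectorCalculus.kineticEnergy (u t) := by
      unfold VectorCalculus.kineticEnergy; ring
    linarith
  · intro M c t hM hc hcM ht
    have hc0 : 0 < c := by linarith
    have hcu : ∀ x, ‖u 0 x‖ ≤ c := fun x => by linarith [hu0 x]
    have h1 := hE ν T hν hT u p hcl hLH hdec c hc0 hcu t ht
    have h2 := hPW M c t hM hc hcM hc0 ht
    linarith

end Summit.NavierStokesRegularity.NavierStokesRegularity.Theorems.LevelSetClosure

end
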